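import Summits.RiemannHypothesis.RiemannHypothesis.Theorems.RuelleBandBandEngineCore

/-!
# `AsymptoticCriticalLine` (crux stmt-RiemannHypothesis-2063): a windowed three-circle realisation
# outputs the INTERIOR half of the crux

Support file of the line `interior-edge-split` (lead prover-line-stmt-RiemannHypothesis-2063-0).  The
planner's "For the tenure planner (b)/(c)" typing made a theorem: IF for every weight window
`a ∈ (0, 1/2)` the zeros of `ζ` with `a < Re s < 1 − a` are realised as joint eigenvalues `s − 1/2` of an
`ℝ`-indexed family `T` of bounded operators on a complex Hilbert space with `T t₀ = S + K` (`t₀ > 0`,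
`K` compact), `σ(S)` disjoint from the open annulus `1 < ‖μ‖ < e^{(1/2−a)t₀}` (essential spectrum is
allowed on the unit circle AND on the edge circle `‖μ‖ = e^{(1/2−a)t₀}` — refuter #3's typing
constraint (γ), corrected) and one resolvent point of `T t₀` in that annulus, THEN the line's stub 1
("no right-interior band") holds (`noRightInteriorBand_of_windowedRealisation`; engine:
`RuelleBand.finite_jointEigenvalues_annulus`, `RuelleBandBandEngineCore.lean`).  The edge stub (route
Strip's crux) is out of reach of this mechanism by design.  As an `∃`-statement the hypothesis is
circular (the diagonal model under stub 1 satisfies it); it types what a PINNED construction over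
`Literature.NumberTheory.Automorphic.Meyer.ideleClassSchwartzWeighted ℚ (a, 1−a)` must deliver.
-/

noncomputable section

namespace Summit.RiemannHypothesis.RiemannHypothesis.Theorems

open Complex Filter Topology Set Metric

/-! ## 8. The windowed (three-circle) realisation outputs the INTERIOR half of the crux -/

/-- **Windowed three-circle realisation ⟹ no right-interior band** (line `interior-edge-split` of crux
stmt-RiemannHypothesis-2063: the honest landing type of route RuelleBand's construction programme
`MeyerLasotaYorke` re-posed on the annulus engine `RuelleBand.finite_jointEigenvalues_annulus`).
Suppose that for every weight window `a ∈ (0, 1/2)` there are a complex Hilbert space, an `ℝ`-indexed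
family `T` of bounded operators and `t₀ > 0` with `T t₀ = S + K`, `K` compact, `σ(S)` disjoint from the
open annulus `1 < ‖μ‖ < e^{(1/2 − a) t₀}` (e.g. `σ(S)` on the unit circle and the edge circle
`‖μ‖ = e^{(1/2−a)t₀}`, where a weight-`(a, 1−a)` completion of Meyer's `H⁰₋` is expected to carry
essential spectrum), one resolvent point of `T t₀` in that annulus, and every zero `s` of `ζ` with
`a < Re s < 1 − a` realised as a joint eigenvalue `z = s − 1/2`. Then the real parts of the zeros do not
accumulate at any `σ₀ ∈ (1/2, 1)` — the line's stub `stub_noRightInteriorBand`, verbatim. (Never the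
edge: the window `a ↓ 0` reaches every interior abscissa, not `σ₀ = 1`.) As an `∃`-statement the
hypothesis is circular (diagonal model under stub 1); its role is to type what a PINNED construction must
deliver. -/
theorem noRightInteriorBand_of_windowedRealisation :
    (∀ a : ℝ, 0 < a → a < 1 / 2 →
      ∃ (H : Type) (_ : NormedAddCommGroup H) (_ : InnerProductSpace ℂ H) (_ : CompleteSpace H)
        (T : ℝ → H →L[ℂ] H) (t₀ : ℝ) (S K : H →L[ℂ] H),
        0 < t₀ ∧ IsCompactOperator K ∧ T t₀ = S + K ∧
        ({μ : ℂ | 1 < ‖μ‖ ∧ ‖μ‖ < Real.exp ((1 / 2 - a) * t₀)} ⊆ resolventSet ℂ S) ∧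
        (∃ μ₀ : ℂ, (1 < ‖μ₀‖ ∧ ‖μ₀‖ < Real.exp ((1 / 2 - a) * t₀)) ∧ μ₀ ∈ resolventSet ℂ (T t₀)) ∧
        (∀ s : ℂ, riemannZeta s = 0 → a < s.re → s.re < 1 - a →
          ∃ v : H, v ≠ 0 ∧ ∀ t : ℝ, T t v = Complex.exp (↑t * (s - 1 / 2)) • v)) →
    ∀ σ₀ : ℝ, 1 / 2 < σ₀ → σ₀ < 1 →
      ∃ ε : ℝ, 0 < ε ∧ {s : ℂ | riemannZeta s = 0 ∧ 0 < s.re ∧ s.re < 1 ∧ |s.re - σ₀| < ε}.Finite := by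
  intro hW σ₀ hσ₀ hσ₁
  -- the window `a = (1 - σ₀)/2` and the radius `ε`
  obtain ⟨H, _, _, _, T, t₀, S, K, ht₀, hK, hSK, hS, ⟨μ₀, hμ₀, hμ₀ρ⟩, hzeros⟩ :=
    hW ((1 - σ₀) / 2) (by linarith) (by linarith)
  set ε : ℝ := min ((σ₀ - 1 / 2) / 2) ((1 - σ₀) / 4) with hε
  have hε0 : 0 < ε := lt_min (by linarith) (by linarith)
  have hε1 : ε ≤ (σ₀ - 1 / 2) / 2 := min_le_left _ _
  have hε2 : ε ≤ (1 - σ₀) / 4 := min_le_right _ _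
  refine ⟨ε, hε0, ?_⟩
  -- the annulus engine with `a' = 0`, `b' = 1/2 - a`, margin `ε' = min (σ₀ - ε - 1/2) ((1 - σ₀)/2 - ε)`
  set ε' : ℝ := min (σ₀ - ε - 1 / 2) ((1 - σ₀) / 2 - ε) with hε'
  have hε'0 : 0 < ε' := lt_min (by linarith) (by linarith)
  have hS' : {μ : ℂ | Real.exp (0 * t₀) < ‖μ‖ ∧ ‖μ‖ < Real.exp ((1 / 2 - (1 - σ₀) / 2) * t₀)} ⊆
      resolventSet ℂ S := by
    intro μ hμ; rw [zero_mul, Real.exp_zero] at hμ; exact hS hμ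
  have hμ₀' : Real.exp (0 * t₀) < ‖μ₀‖ ∧ ‖μ₀‖ < Real.exp ((1 / 2 - (1 - σ₀) / 2) * t₀) := by
    rw [zero_mul, Real.exp_zero]; exact hμ₀
  have hfin := RuelleBand.finite_jointEigenvalues_annulus T ht₀ S K hK hSK
    (a := 0) (b := 1 / 2 - (1 - σ₀) / 2) (by linarith) hS' hμ₀' hμ₀ρ hε'0
  refine ((hfin.image fun z : ℂ => z + 1 / 2).subset ?_)
  rintro s ⟨hz, -, -, hs⟩
  rw [abs_sub_lt_iff] at hs
  obtain ⟨v, hv0, hv⟩ := hzeros s hz (by linarith) (by linarith)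
  have hm1 : ε' ≤ σ₀ - ε - 1 / 2 := min_le_left _ _
  have hm2 : ε' ≤ (1 - σ₀) / 2 - ε := min_le_right _ _
  refine ⟨s - 1 / 2, ⟨⟨?_, ?_⟩, v, hv0, fun t => by rw [hv t]⟩, by ring⟩
  · simp only [Complex.sub_re, Complex.div_ofNat_re, Complex.one_re]
    linarith
  · simp only [Complex.sub_re, Complex.div_ofNat_re, Complex.one_re]
    linarith

end Summit.RiemannHypothesis.RiemannHypothesis.Theorems

end
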